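import Mathlib
import Summits.PneNP.PneNP.Theorems.ConvexRankGatesConvexGateBlindMonoMomentVar
import Summits.PneNP.PneNP.Theorems.ConvexRankGatesConvexGateBlindCatchTwoMatrix

/-!
# PneNP / ConvexRankGates — `ConvexGateBlind`: the third-generation catch bound, matrix form

Helpers (`--supports stmt-PneNP-10680`), COLUMN-SPACE line (prover seat 2, session 16): `…CatchTwoMatrix.card_monoMass_gt_le_two`
with the VARIANCE-SENSITIVE moment bound `…MonoMomentVar.expMoment_le_var` in case (A). With `λ = q/(24DL)` (admissible when
`q ≤ 12L`) the first term becomes `q^m · exp(−q·W/(288·D·L))` instead of `q^m · exp(−W/(1152·D·L))`: a gain `4q` in the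
exponent (stub `catch_var_matrix`). Case (B) and the quarter hypothesis are unchanged. [new]
-/

set_option linter.dupNamespace false

namespace Summit.PneNP.PneNP.Theorems

open Finset Real

noncomputable section

variable {m : ℕ}

/-- **Third-generation catch bound, matrix form.** See the module docstring. [new] -/
theorem card_monoMass_gt_le_var {q : ℕ} (hq : 3 ≤ q) (V : Fin m → Fin m → ℝ) (hVsym : ∀ x y, V x y = V y x)
    (hV0 : ∀ x, V x x = 0) {W L β D : ℝ} (hWpos : 0 < W) (hL1 : 1 ≤ L) (hLq : (q : ℝ) ≤ 12 * L) (hβ0 : 0 < β) (hD : 0 < D)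
    (hdegsum : ∑ x, ∑ y, |V x y| ≤ 2 * L * W) (hVle : ∀ x y, V x y ≤ β * W)
    (hmass : ∑ x, ∑ y, V x y = 2 * W) (H : Finset (Fin m)) (hHdeg : ∀ x, x ∉ H → ∑ y, |V x y| ≤ D)
    (hneg : (∑ a ∈ H, ∑ b ∈ H, max (-V a b) 0) / 2 ≤
      (1 / 4) * ((∑ x, ∑ y, V x y) / 2 - (∑ a ∈ H, ∑ b ∈ H, V a b) / 2)) :
    ((((Finset.univ : Finset (Fin m → Fin q)).filter fun c =>
        W < (∑ a, ∑ b, if c a = c b then V a b else 0) / 2).card : ℝ)) ≤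
      (q : ℝ) ^ m * Real.exp (-((q : ℝ) * W / (288 * D * L))) + (q : ℝ) ^ m * Real.exp (-(1 / (5200 * Real.sqrt β))) := by
  classical
  have hqpos : 0 < q := by omega
  have hqR3 : (3 : ℝ) ≤ q := by exact_mod_cast hq
  have hqRpos : (0 : ℝ) < q := by linarith
  have hLpos : 0 < L := by linarith
  have hsqβ : 0 < Real.sqrt β := Real.sqrt_pos.2 hβ0
  have hβW : 0 ≤ β * W := (mul_pos hβ0 hWpos).le
  -- the positive part and the masses inside `H`
  set Vp : Fin m → Fin m → ℝ := fun a b => max (V a b) 0 with hVp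
  have hVp0 : ∀ a b, 0 ≤ Vp a b := fun a b => le_max_right _ _
  have hVle' : ∀ a b, V a b ≤ Vp a b := fun a b => le_max_left _ _
  have hVsplit : ∀ a b, V a b = Vp a b - max (-V a b) 0 := fun a b => (max_zero_sub_max_neg_zero_eq_self (V a b)).symm
  obtain ⟨massH, hmassH⟩ : ∃ x : ℝ, x = (∑ a ∈ H, ∑ b ∈ H, V a b) / 2 := ⟨_, rfl⟩
  obtain ⟨posH, hposH⟩ : ∃ x : ℝ, x = (∑ a ∈ H, ∑ b ∈ H, Vp a b) / 2 := ⟨_, rfl⟩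
  obtain ⟨negH, hnegH⟩ : ∃ x : ℝ, x = (∑ a ∈ H, ∑ b ∈ H, max (-V a b) 0) / 2 := ⟨_, rfl⟩
  obtain ⟨massOut, hmassOut⟩ : ∃ x : ℝ, x = (∑ x, ∑ y, V x y) / 2 - (∑ a ∈ H, ∑ b ∈ H, V a b) / 2 := ⟨_, rfl⟩
  have hnegH0 : 0 ≤ negH := by
    rw [hnegH]; exact div_nonneg (Finset.sum_nonneg fun a _ => Finset.sum_nonneg fun b _ => le_max_right _ _) (by norm_num)
  have hsplitH : massH = posH - negH := by
    rw [hmassH, hposH, hnegH, ← sub_div, ← Finset.sum_sub_distrib]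
    congr 1
    refine Finset.sum_congr rfl fun a _ => ?_
    rw [← Finset.sum_sub_distrib]
    exact Finset.sum_congr rfl fun b _ => hVsplit a b
  have hWsplit : W = massOut + massH := by rw [hmassOut, hmassH, hmass]; ring
  rw [← hnegH, ← hmassOut] at hneg
  have hmassOut0 : 0 ≤ massOut := by linarith
  -- monochromatic masses
  set MH : (Fin m → Fin q) → ℝ := fun c => (∑ a ∈ H, ∑ b ∈ H, if c a = c b then V a b else 0) / 2 with hMH
  set monoPos : (Fin m → Fin q) → ℝ := fun c => (∑ a ∈ H, ∑ b ∈ H, if c a = c b then Vp a b else 0) / 2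
    with hmonoPos
  have hMH_le : ∀ c, MH c ≤ monoPos c := by
    intro c
    simp only [hMH, hmonoPos]
    refine div_le_div_of_nonneg_right (Finset.sum_le_sum fun a _ => Finset.sum_le_sum fun b _ => ?_) (by norm_num)
    split_ifs
    · exact hVle' a b
    · exact le_rfl
  have hmonoPos_le : ∀ c, monoPos c ≤ posH := by
    intro c
    simp only [hmonoPos, hposH]
    refine div_le_div_of_nonneg_right (Finset.sum_le_sum fun a _ => Finset.sum_le_sum fun b _ => ?_) (by norm_num)
    split_ifs
    · exact le_rfl
    · exact hVp0 a b
  -- the centred outside mass `Dev` of `expMoment_le`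
  obtain ⟨Dev, hDev⟩ : ∃ T : (Fin m → Fin q) → ℝ, ∀ c, T c =
      (∑ a, ∑ b, if c a = c b then V a b else 0) / 2 - (∑ a ∈ H, ∑ b ∈ H, if c a = c b then V a b else 0) / 2 -
        ((∑ a, ∑ b, V a b) / 2 - (∑ a ∈ H, ∑ b ∈ H, V a b) / 2) / q := ⟨fun c => _, fun c => rfl⟩
  -- the restricted positive part as a matrix on `Fin m`
  set V' : Fin m → Fin m → ℝ := fun a b => if a ∈ H ∧ b ∈ H then Vp a b else 0 with hV'
  have hV'sym : ∀ x y, V' x y = V' y x := by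
    intro x y
    simp only [hV', hVp]
    by_cases hx : x ∈ H <;> by_cases hy : y ∈ H <;> simp [hx, hy, hVsym x y]
  have hV'0 : ∀ x, V' x x = 0 := by
    intro x; simp only [hV', hVp, hV0, max_self]; split_ifs <;> rfl
  have hV'nn : ∀ x y, 0 ≤ V' x y := by
    intro x y; simp only [hV']; split_ifs
    · exact hVp0 x y
    · exact le_rfl
  have hV'le : ∀ x y, V' x y ≤ β * W := by
    intro x y; simp only [hV']; split_ifs
    · exact max_le (hVle x y) hβW
    · exact hβW
  have hV'mass : ∑ x, ∑ y, V' x y = 2 * posH := by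
    rw [hV', sum_sum_ite_mem_and, hposH]; ring
  have hV'mono : ∀ c : Fin m → Fin q, (∑ a, ∑ b, if c a = c b then V' a b else 0) / 2 = monoPos c := by
    intro c
    simp only [hmonoPos]
    congr 1
    rw [← sum_sum_ite_mem_and H (fun a b => if c a = c b then Vp a b else 0)]
    refine Finset.sum_congr rfl fun a _ => Finset.sum_congr rfl fun b _ => ?_
    simp only [hV']
    split_ifs <;> rfl
  -- the two events
  set A : Finset (Fin m → Fin q) := (Finset.univ : Finset (Fin m → Fin q)).filter (fun c => W / 6 ≤ Dev c) with hA
  set B : Finset (Fin m → Fin q) := (Finset.univ : Finset (Fin m → Fin q)).filter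
    (fun c => 2 / 3 * posH ≤ (∑ a, ∑ b, if c a = c b then V' a b else 0) / 2) with hB
  -- Case analysis: a bad colouring outside `A` forces `posH > 3W/5` and lies in `B`
  have hcaseB : ∀ c : Fin m → Fin q, W < (∑ a, ∑ b, if c a = c b then V a b else 0) / 2 → ¬ (W / 6 ≤ Dev c) →
      3 / 5 * W < posH ∧ 2 / 3 * posH ≤ (∑ a, ∑ b, if c a = c b then V' a b else 0) / 2 := by
    intro c hbad hnotA
    rw [not_le, hDev c] at hnotA
    rw [hV'mono c]
    have h1 := hMH_le c
    have h2 := hmonoPos_le c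
    simp only [hMH] at h1
    -- `Φ = W - massOut/q - MH c < W/6`
    have hΦ : W - massOut / q - (∑ a ∈ H, ∑ b ∈ H, if c a = c b then V a b else 0) / 2 < W / 6 := by
      rw [hmassOut]; linarith
    -- `massOut/q ≤ massOut/3`
    have hq' : massOut / q ≤ massOut / 3 := div_le_div_of_nonneg_left hmassOut0 (by norm_num) hqR3
    -- lower bound `Φ ≥ (5/12) massOut + (posH - monoPos c)`
    have hlow : 5 / 12 * massOut + (posH - monoPos c) < W / 6 := by
      have : W - massOut / q - (∑ a ∈ H, ∑ b ∈ H, if c a = c b then V a b else 0) / 2 ≥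
          massOut + (posH - negH) - massOut / 3 - monoPos c := by
        rw [hWsplit, hsplitH] at *
        linarith
      linarith
    have hbich : 0 ≤ posH - monoPos c := by linarith
    have hmo : massOut < 2 / 5 * W := by linarith
    have hpos : 3 / 5 * W < posH := by
      have : posH = W - massOut + negH := by rw [hWsplit, hsplitH]; ring
      rw [this]; linarith
    refine ⟨hpos, ?_⟩
    linarith
  -- hence `BAD ⊆ A ∪ B` when `3W/5 < posH`, and `BAD ⊆ A` otherwise
  have hcardA : ((A.card : ℝ)) ≤ (q : ℝ) ^ m * Real.exp (-((q : ℝ) * W / (288 * D * L))) := by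
    obtain ⟨lam, hlam⟩ : ∃ lam : ℝ, lam = (q : ℝ) / (24 * D * L) := ⟨_, rfl⟩
    have hlam0 : 0 ≤ lam := by rw [hlam]; positivity
    have hdegH' : ∀ x, x ∉ H → 2 * lam * ∑ y, |V x y| ≤ 1 := by
      intro x hx
      calc 2 * lam * ∑ y, |V x y| ≤ 2 * lam * D := mul_le_mul_of_nonneg_left (hHdeg x hx) (by positivity)
        _ = (q : ℝ) / (12 * L) := by rw [hlam]; field_simp; ring
        _ ≤ 1 := by rw [div_le_one (by positivity)]; linarith
    have hmom := expMoment_le_var V hVsym hV0 hqpos H hlam0 hdegH' (q := q)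
    simp only [← hDev] at hmom
    have hmarkov := card_filter_le_mul_exp Dev hlam0 (W / 6)
    have hdeg0 : ∀ x, 0 ≤ ∑ y, |V x y| := fun x => Finset.sum_nonneg fun y _ => abs_nonneg _
    have hdeg2 : ∑ x ∈ Hᶜ, (∑ y, |V x y|) ^ 2 ≤ D * (2 * L * W) := by
      calc ∑ x ∈ Hᶜ, (∑ y, |V x y|) ^ 2 ≤ ∑ x ∈ Hᶜ, D * ∑ y, |V x y| := by
            refine Finset.sum_le_sum fun x hx => ?_
            rw [sq]
            exact mul_le_mul_of_nonneg_right (hHdeg x (Finset.mem_compl.1 hx)) (hdeg0 x)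
        _ = D * ∑ x ∈ Hᶜ, ∑ y, |V x y| := by rw [Finset.mul_sum]
        _ ≤ D * ∑ x, ∑ y, |V x y| := by
            refine mul_le_mul_of_nonneg_left ?_ hD.le
            exact Finset.sum_le_sum_of_subset_of_nonneg (Finset.subset_univ _) fun x _ _ => hdeg0 x
        _ ≤ D * (2 * L * W) := mul_le_mul_of_nonneg_left hdegsum hD.le
    have h1 : Real.exp (lam ^ 2 / q * ∑ x ∈ Hᶜ, (∑ y, |V x y|) ^ 2) ≤ Real.exp (lam ^ 2 / q * (D * (2 * L * W))) :=
      Real.exp_le_exp.2 (mul_le_mul_of_nonneg_left hdeg2 (by positivity))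
    have h2 : -(lam * (W / 6)) + lam ^ 2 / q * (D * (2 * L * W)) = -((q : ℝ) * W / (288 * D * L)) := by
      rw [hlam]; field_simp; ring
    calc ((A.card : ℝ)) ≤ Real.exp (-(lam * (W / 6))) * ∑ c, Real.exp (lam * Dev c) := hmarkov
      _ ≤ Real.exp (-(lam * (W / 6))) * ((q : ℝ) ^ m * Real.exp (lam ^ 2 / q * ∑ x ∈ Hᶜ, (∑ y, |V x y|) ^ 2)) :=
          mul_le_mul_of_nonneg_left hmom (Real.exp_pos _).le
      _ ≤ Real.exp (-(lam * (W / 6))) * ((q : ℝ) ^ m * Real.exp (lam ^ 2 / q * (D * (2 * L * W)))) :=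
          mul_le_mul_of_nonneg_left (mul_le_mul_of_nonneg_left h1 (by positivity)) (Real.exp_pos _).le
      _ = (q : ℝ) ^ m * Real.exp (-(lam * (W / 6)) + lam ^ 2 / q * (D * (2 * L * W))) := by
          rw [Real.exp_add]; ring
      _ = (q : ℝ) ^ m * Real.exp (-((q : ℝ) * W / (288 * D * L))) := by rw [h2]
  have hexpB0 : 0 ≤ (q : ℝ) ^ m * Real.exp (-(1 / (5200 * Real.sqrt β))) := by positivity
  by_cases hpos : 3 / 5 * W < posH
  · -- `BAD ⊆ A ∪ B`
    have hposH0 : 0 < posH := by linarith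
    have hsub : ((Finset.univ : Finset (Fin m → Fin q)).filter fun c =>
          W < (∑ a, ∑ b, if c a = c b then V a b else 0) / 2) ⊆ A ∪ B := by
      intro c hc
      rw [Finset.mem_filter] at hc
      rw [Finset.mem_union]
      by_cases hcA : W / 6 ≤ Dev c
      · exact Or.inl (Finset.mem_filter.2 ⟨Finset.mem_univ _, hcA⟩)
      · exact Or.inr (Finset.mem_filter.2 ⟨Finset.mem_univ _, (hcaseB c hc.2 hcA).2⟩)
    have hcardB : ((B.card : ℝ)) ≤ (q : ℝ) ^ m * Real.exp (-(1 / (5200 * Real.sqrt β))) := by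
      have hB1 := card_monoMass_ge_twoThirds_le hq V' hV'sym hV'0 hV'nn hposH0 (mul_pos hβ0 hWpos) hV'mass hV'le
      refine hB1.trans (mul_le_mul_of_nonneg_left (Real.exp_le_exp.2 ?_) (by positivity))
      -- `1/(5200 √β) ≤ posH / (1152 √(12 posH (βW)))`
      have hs0 : 0 < Real.sqrt (12 * posH * (β * W)) := Real.sqrt_pos.2 (by positivity)
      have hkey : 1152 * Real.sqrt (12 * posH * (β * W)) ≤ 5200 * Real.sqrt β * posH := by
        have hrhs0 : 0 ≤ 5200 / 1152 * Real.sqrt β * posH := by positivity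
        have h := (Real.sqrt_le_left hrhs0).2 (show 12 * posH * (β * W) ≤ (5200 / 1152 * Real.sqrt β * posH) ^ 2 by
          rw [mul_pow, mul_pow, Real.sq_sqrt hβ0.le]
          nlinarith [mul_pos hβ0 hWpos, mul_pos hβ0 hposH0])
        linarith
      rw [neg_le_neg_iff, div_le_div_iff₀ (by positivity) (by positivity)]
      linarith
    calc ((((Finset.univ : Finset (Fin m → Fin q)).filter fun c =>
            W < (∑ a, ∑ b, if c a = c b then V a b else 0) / 2).card : ℝ))
        ≤ ((A ∪ B).card : ℝ) := by exact_mod_cast Finset.card_le_card hsub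
      _ ≤ (A.card : ℝ) + (B.card : ℝ) := by exact_mod_cast Finset.card_union_le A B
      _ ≤ _ := add_le_add hcardA hcardB
  · -- `BAD ⊆ A`
    have hsub : ((Finset.univ : Finset (Fin m → Fin q)).filter fun c =>
          W < (∑ a, ∑ b, if c a = c b then V a b else 0) / 2) ⊆ A := by
      intro c hc
      rw [Finset.mem_filter] at hc
      by_cases hcA : W / 6 ≤ Dev c
      · exact Finset.mem_filter.2 ⟨Finset.mem_univ _, hcA⟩
      · exact absurd (hcaseB c hc.2 hcA).1 hpos
    calc ((((Finset.univ : Finset (Fin m → Fin q)).filter fun c =>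
            W < (∑ a, ∑ b, if c a = c b then V a b else 0) / 2).card : ℝ))
        ≤ (A.card : ℝ) := by exact_mod_cast Finset.card_le_card hsub
      _ ≤ (q : ℝ) ^ m * Real.exp (-((q : ℝ) * W / (288 * D * L))) := hcardA
      _ ≤ _ := le_add_of_nonneg_right hexpB0

/-- **Third-generation catch bound, matrix form** (registered form of `card_monoMass_gt_le_var`). [new] -/
theorem catch_var_matrix : ∀ {m q : ℕ}, 3 ≤ q → ∀ (V : Fin m → Fin m → ℝ), (∀ x y, V x y = V y x) → (∀ x, V x x = 0) → ∀ (W L β D : ℝ), 0 < W → 1 ≤ L → (q : ℝ) ≤ 12 * L → 0 < β → 0 < D → ∑ x, ∑ y, |V x y| ≤ 2 * L * W → (∀ x y, V x y ≤ β * W) → ∑ x, ∑ y, V x y = 2 * W → ∀ (H : Finset (Fin m)), (∀ x, x ∉ H → ∑ y, |V x y| ≤ D) → (∑ a ∈ H, ∑ b ∈ H, max (-V a b) 0) / 2 ≤ (1 / 4) * ((∑ x, ∑ y, V x y) / 2 - (∑ a ∈ H, ∑ b ∈ H, V a b) / 2) → ((((Finset.univ : Finset (Fin m → Fin q)).filter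 fun c => W < (∑ a, ∑ b, if c a = c b then V a b else 0) / 2).card : ℝ)) ≤ (q : ℝ) ^ m * Real.exp (-((q : ℝ) * W / (288 * D * L))) + (q : ℝ) ^ m * Real.exp (-(1 / (5200 * Real.sqrt β))) :=
  fun hq V hVsym hV0 _ _ _ _ hW hL hLq hβ hD hdegsum hVle hmass H hHdeg hneg =>
    card_monoMass_gt_le_var hq V hVsym hV0 hW hL hLq hβ hD hdegsum hVle hmass H hHdeg hneg

end

end Summit.PneNP.PneNP.Theorems
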